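import Summits.AnomalousDissipation.AnomalousDissipation.Theorems.WazewskiBlockSubLaminarObliqueLaminar
import Summits.AnomalousDissipation.AnomalousDissipation.Theorems.WazewskiBlockSubLaminarObliqueBlocks

/-!
# Route `WazewskiBlock`, item stmt-AnomalousDissipation-10354 — the Galerkin field along an increment at the laminar state

Linearity of `Φ`, `Ψ`, the expansion of `Φ y` through `repField`, the two-term convolution by/of
the laminar shear, invisibility of the Leray symbol in transversal coordinates, and the exact
expansion `G(x + y) = G x + Lin y + Rem y` (`obliqueField_add`). All statements proved.
-/

noncomputable section

set_option linter.dupNamespace false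

open scoped InnerProductSpace ComplexConjugate
open Finset
open Literature.Analysis.FunctionSpaces Literature.Analysis.FunctionSpaces.Torus
open Literature.Analysis.FluidPDE Literature.Analysis.FluidPDE.Torus

namespace Summit.AnomalousDissipation.AnomalousDissipation.Theorems.Oblique
/-! ### Linearity of `Φ` and `Ψ` -/

/-- `Φ` is additive. [folklore] -/
theorem obliqueCoeff_add {N : ℕ} (x y : ObliqueIndex N → ℝ) :
    obliqueCoeff N (x + y) = obliqueCoeff N x + obliqueCoeff N y := by
  funext k
  rw [Pi.add_apply]
  by_cases hk : (k : Fin 3 → ℤ) ∈ obliqueReps N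
  · simp only [obliqueCoeff_apply_of_mem _ hk, Pi.add_apply, add_smul, Finset.sum_add_distrib, map_add,
      smul_add]
  · by_cases hk' : -(k : Fin 3 → ℤ) ∈ obliqueReps N
    · simp only [obliqueCoeff_apply_of_neg_mem _ hk', Pi.add_apply, add_smul, Finset.sum_add_distrib, map_add,
        smul_add, neg_add]
    · have hkm : (k : Fin 3 → ℤ) ∉ obliqueModes N := fun h => (mem_obliqueReps_or_neg_mem h).elim hk hk'
      simp only [obliqueCoeff_apply_of_not_mem _ hkm, add_zero]

/-- `Φ` is homogeneous. [folklore] -/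
theorem obliqueCoeff_smul {N : ℕ} (a : ℝ) (x : ObliqueIndex N → ℝ) :
    obliqueCoeff N (a • x) = a • obliqueCoeff N x := by
  funext k
  rw [Pi.smul_apply]
  by_cases hk : (k : Fin 3 → ℤ) ∈ obliqueReps N
  · simp only [obliqueCoeff_apply_of_mem _ hk, Pi.smul_apply, smul_eq_mul, mul_smul, ← Finset.smul_sum,
      LinearIsometry.map_smul, smul_comm a Complex.I]
  · by_cases hk' : -(k : Fin 3 → ℤ) ∈ obliqueReps N
    · simp only [obliqueCoeff_apply_of_neg_mem _ hk', Pi.smul_apply, smul_eq_mul, mul_smul, ← Finset.smul_sum,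
        LinearIsometry.map_smul, smul_comm a Complex.I, smul_neg]
    · have hkm : (k : Fin 3 → ℤ) ∉ obliqueModes N := fun h => (mem_obliqueReps_or_neg_mem h).elim hk hk'
      simp only [obliqueCoeff_apply_of_not_mem _ hkm, smul_zero]

/-- `Ψ` is additive. [folklore] -/
theorem obliqueCoord_add {N : ℕ} (u v : ↥(freqBall (d := Fin 3) N) → EuclideanSpace ℂ (Fin 3)) :
    obliqueCoord N (u + v) = obliqueCoord N u + obliqueCoord N v := by
  funext p
  simp only [obliqueCoord, Pi.add_apply, PiLp.add_apply, Complex.add_im, mul_add, Finset.sum_add_distrib]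

/-- `Ψ` commutes with negation. [folklore] -/
theorem obliqueCoord_neg {N : ℕ} (u : ↥(freqBall (d := Fin 3) N) → EuclideanSpace ℂ (Fin 3)) :
    obliqueCoord N (-u) = -obliqueCoord N u := by
  funext p
  simp only [obliqueCoord, Pi.neg_apply, PiLp.neg_apply, Complex.neg_im, mul_neg, Finset.sum_neg_distrib]

/-- `Ψ` is homogeneous. [folklore] -/
theorem obliqueCoord_smul {N : ℕ} (a : ℝ) (u : ↥(freqBall (d := Fin 3) N) → EuclideanSpace ℂ (Fin 3)) :
    obliqueCoord N (a • u) = a • obliqueCoord N u := by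
  funext p
  simp only [obliqueCoord, Pi.smul_apply, PiLp.smul_apply, Complex.real_smul, Complex.mul_im,
    Complex.ofReal_re, Complex.ofReal_im, zero_mul, add_zero, smul_eq_mul, Finset.mul_sum]
  exact Finset.sum_congr rfl fun j _ => by ring

/-! ### `Φ y` through the basis fields `repField` -/

/-- **`(Φ y)‾ k = i · ∑_q y_q repField q k`** for every `k ∈ ℤ³` (both sides vanish off the
lattice). [folklore] -/
theorem coeffExt_obliqueCoeff_eq_repField {N : ℕ} (y : ObliqueIndex N → ℝ) (k : Fin 3 → ℤ) :
    coeffExt (freqBall (d := Fin 3) N) (obliqueCoeff N y) k =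
      Complex.I • EuclideanSpace.complexify (∑ q : ObliqueIndex N, y q • repField q k) := by
  by_cases hkS : k ∈ freqBall (d := Fin 3) N
  · rw [coeffExt_of_mem _ hkS]
    by_cases hk : k ∈ obliqueReps N
    · rw [obliqueCoeff_apply_of_mem y (k := ⟨k, hkS⟩) hk]
      congr 2
      rw [Fintype.sum_prod_type]
      simp only
      rw [Finset.sum_eq_single_of_mem (⟨k, hk⟩ : ↥(obliqueReps N)) (Finset.mem_univ _) fun k' _ hk' => ?_]
      · refine Finset.sum_congr rfl fun σ _ => ?_
        simp [repField]
      · refine Finset.sum_eq_zero fun σ _ => ?_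
        have h1 : k ≠ (k' : Fin 3 → ℤ) := fun h => hk' (Subtype.ext h.symm)
        have h2 : k ≠ -(k' : Fin 3 → ℤ) := fun h => not_neg_mem_obliqueReps k'.2 (h ▸ hk)
        simp [repField, h1, h2]
    · by_cases hk' : -k ∈ obliqueReps N
      · rw [obliqueCoeff_apply_of_neg_mem y (k := ⟨k, hkS⟩) hk']
        rw [← smul_neg, ← map_neg]
        congr 2
        rw [Fintype.sum_prod_type]
        simp only
        rw [Finset.sum_eq_single_of_mem (⟨-k, hk'⟩ : ↥(obliqueReps N)) (Finset.mem_univ _) fun k'' _ hk'' => ?_]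
        · rw [← Finset.sum_neg_distrib]
          refine Finset.sum_congr rfl fun σ _ => ?_
          have h1 : k ≠ -k := fun h => hk (by rwa [← h] at hk')
          simp [repField, h1, neg_neg, smul_neg]
        · refine Finset.sum_eq_zero fun σ _ => ?_
          have h1 : k ≠ (k'' : Fin 3 → ℤ) := fun h => hk (h ▸ k''.2)
          have h2 : k ≠ -(k'' : Fin 3 → ℤ) := fun h => hk'' (Subtype.ext (by simp [h]))
          simp [repField, h1, h2]
      · have hkm : k ∉ obliqueModes N := fun h => (mem_obliqueReps_or_neg_mem h).elim hk hk'
        rw [obliqueCoeff_apply_of_not_mem y (k := ⟨k, hkS⟩) hkm]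
        have : ∑ q : ObliqueIndex N, y q • repField q k = 0 := by
          refine Finset.sum_eq_zero fun q _ => ?_
          have h1 : k ≠ (q.1 : Fin 3 → ℤ) := fun h => hk (h ▸ q.1.2)
          have h2 : k ≠ -(q.1 : Fin 3 → ℤ) := fun h => hk' (by rw [h, neg_neg]; exact q.1.2)
          simp [repField, h1, h2]
        rw [this, map_zero, smul_zero]
  · rw [coeffExt_of_not_mem _ hkS]
    have : ∑ q : ObliqueIndex N, y q • repField q k = 0 := by
      refine Finset.sum_eq_zero fun q _ => ?_
      have h1 : k ≠ (q.1 : Fin 3 → ℤ) := fun h => hkS (h ▸ mem_freqBall_of_mem_obliqueReps q.1.2)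
      have h2 : k ≠ -(q.1 : Fin 3 → ℤ) := fun h =>
        hkS (h ▸ neg_mem_freqBall.2 (mem_freqBall_of_mem_obliqueReps q.1.2))
      simp [repField, h1, h2]
    rw [this, map_zero, smul_zero]

/-! ### Convection by / of the laminar shear: two-term shifts -/

/-- **Convection BY a field supported on `±e`** collapses to two shifts:
`conv S c₀ h k = (2πi c₀(e)·(k-e)) • h (k-e) + (2πi c₀(-e)·(k+e)) • h (k+e)`, for `h` vanishing
off `S` and `±e ∈ S`. [folklore] -/
theorem convectionCoeff_of_support_pair {S : Finset (Fin 3 → ℤ)} (he : modeE ∈ S) (hne : -modeE ∈ S)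
    {c₀ h : (Fin 3 → ℤ) → EuclideanSpace ℂ (Fin 3)} (hc₀ : ∀ l, l ≠ modeE → l ≠ -modeE → c₀ l = 0)
    (hh : ∀ m, m ∉ S → h m = 0) (k : Fin 3 → ℤ) :
    convectionCoeff S c₀ h k =
      (2 * Real.pi * Complex.I * ∑ j, c₀ modeE j * ((k - modeE) j : ℂ)) • h (k - modeE) +
        (2 * Real.pi * Complex.I * ∑ j, c₀ (-modeE) j * ((k + modeE) j : ℂ)) • h (k + modeE) := by
  rw [convectionCoeff_def]
  -- inner sums collapse
  have hinner : ∀ l ∈ S, (∑ m ∈ S, if l + m = k then (2 * Real.pi * Complex.I * ∑ j, c₀ l j * (m j : ℂ)) • h m else 0) =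
      (2 * Real.pi * Complex.I * ∑ j, c₀ l j * ((k - l) j : ℂ)) • h (k - l) := by
    intro l _
    have heq : ∀ m, (l + m = k) ↔ (m = k - l) := fun m => by constructor <;> intro h' <;> [rw [← h']; rw [h']] <;> abel
    simp_rw [heq]
    rw [Finset.sum_ite_eq' S (k - l)]
    split_ifs with hmem
    · rfl
    · rw [hh _ hmem, smul_zero]
  rw [Finset.sum_congr rfl hinner]
  have hsub : ({modeE, -modeE} : Finset (Fin 3 → ℤ)) ⊆ S := by
    intro l hl
    rcases Finset.mem_insert.1 hl with rfl | hl
    · exact he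
    · rw [Finset.mem_singleton] at hl; rw [hl]; exact hne
  rw [← Finset.sum_subset hsub fun l _ hl2 => by
    have h1 : l ≠ modeE := fun h => hl2 (by simp [h])
    have h2 : l ≠ -modeE := fun h => hl2 (by simp [h])
    simp [hc₀ l h1 h2]]
  rw [Finset.sum_pair modeE_ne_neg, sub_neg_eq_add]

/-- **Convection OF a field supported on `±e`**:
`conv S h c₀ k = (2πi h(k-e)·e) • c₀ e + (2πi h(k+e)·(-e)) • c₀ (-e)`. [folklore] -/
theorem convectionCoeff_of_support_pair_right {S : Finset (Fin 3 → ℤ)} (he : modeE ∈ S) (hne : -modeE ∈ S)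
    {c₀ h : (Fin 3 → ℤ) → EuclideanSpace ℂ (Fin 3)} (hc₀ : ∀ l, l ≠ modeE → l ≠ -modeE → c₀ l = 0)
    (hh : ∀ m, m ∉ S → h m = 0) (k : Fin 3 → ℤ) :
    convectionCoeff S h c₀ k =
      (2 * Real.pi * Complex.I * ∑ j, h (k - modeE) j * ((modeE) j : ℂ)) • c₀ modeE +
        (2 * Real.pi * Complex.I * ∑ j, h (k + modeE) j * ((-modeE) j : ℂ)) • c₀ (-modeE) := by
  rw [convectionCoeff_def, Finset.sum_comm]
  have hinner : ∀ m ∈ S, (∑ l ∈ S, if l + m = k then (2 * Real.pi * Complex.I * ∑ j, h l j * (m j : ℂ)) • c₀ m else 0) =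
      (2 * Real.pi * Complex.I * ∑ j, h (k - m) j * (m j : ℂ)) • c₀ m := by
    intro m _
    have heq : ∀ l, (l + m = k) ↔ (l = k - m) := fun l => by constructor <;> intro h' <;> [rw [← h']; rw [h']] <;> abel
    simp_rw [heq]
    rw [Finset.sum_ite_eq' S (k - m)]
    split_ifs with hmem
    · rfl
    · rw [hh _ hmem]; simp
  rw [Finset.sum_congr rfl hinner]
  have hsub : ({modeE, -modeE} : Finset (Fin 3 → ℤ)) ⊆ S := by
    intro l hl
    rcases Finset.mem_insert.1 hl with rfl | hl
    · exact he
    · rw [Finset.mem_singleton] at hl; rw [hl]; exact hne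
  rw [← Finset.sum_subset hsub fun m _ hm2 => by
    have h1 : m ≠ modeE := fun h => hm2 (by simp [h])
    have h2 : m ≠ -modeE := fun h => hm2 (by simp [h])
    simp [hc₀ m h1 h2]]
  rw [Finset.sum_pair modeE_ne_neg, sub_neg_eq_add]


/-! ### The linearised convection at the laminar state -/

/-- Support of the extended laminar coefficients: only `±e`. [folklore] -/
theorem coeffExt_laminar_eq_zero {N : ℕ} (ν F : ℝ) (hN : 2 ≤ N) (l : Fin 3 → ℤ) (h1 : l ≠ modeE) (h2 : l ≠ -modeE) :
    coeffExt (freqBall (d := Fin 3) N) (obliqueCoeff N (laminarCoord ν F N)) l = 0 := by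
  by_cases hl : l ∈ freqBall (d := Fin 3) N
  · rw [coeffExt_of_mem _ hl, obliqueCoeff_laminarCoord ν F hN ⟨l, hl⟩, if_neg h1, if_neg h2]
  · exact coeffExt_of_not_mem _ hl

/-- The extended laminar coefficient at `e`. [folklore] -/
theorem coeffExt_laminar_modeE {N : ℕ} (ν F : ℝ) (hN : 2 ≤ N) :
    coeffExt (freqBall (d := Fin 3) N) (obliqueCoeff N (laminarCoord ν F N)) modeE =
      (-(F / (16 * Real.pi ^ 2 * ν) / 2) : ℝ) •
        (Complex.I • EuclideanSpace.complexify (EuclideanSpace.single (0 : Fin 3) (1 : ℝ))) := by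
  rw [coeffExt_of_mem _ (modeE_mem_freqBall hN), obliqueCoeff_laminarCoord ν F hN, if_pos rfl]

/-- The extended laminar coefficient at `-e`. [folklore] -/
theorem coeffExt_laminar_neg_modeE {N : ℕ} (ν F : ℝ) (hN : 2 ≤ N) :
    coeffExt (freqBall (d := Fin 3) N) (obliqueCoeff N (laminarCoord ν F N)) (-modeE) =
      ((F / (16 * Real.pi ^ 2 * ν) / 2) : ℝ) •
        (Complex.I • EuclideanSpace.complexify (EuclideanSpace.single (0 : Fin 3) (1 : ℝ))) := by
  rw [coeffExt_of_mem _ (neg_modeE_mem_freqBall hN), obliqueCoeff_laminarCoord ν F hN,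
    if_neg modeE_ne_neg.symm, if_pos rfl]

/-- Scalar of the advection term: `∑ⱼ ((a • i e₀)ⱼ) mⱼ = a i m₀`. [folklore] -/
theorem sum_laminarVec_mul (a : ℝ) (m : Fin 3 → ℤ) :
    ∑ j, ((a : ℝ) • (Complex.I • EuclideanSpace.complexify (EuclideanSpace.single (0 : Fin 3) (1 : ℝ)))) j *
        ((m j : ℤ) : ℂ) = (a : ℂ) * Complex.I * (m 0 : ℂ) := by
  simp [Fin.sum_univ_three]

/-- Scalar of the stretching term at `e`: `∑ⱼ (i ρ)ⱼ eⱼ = 2 i ρ₁`. [folklore] -/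
theorem sum_I_smul_complexify_mul_modeE (ρ : EuclideanSpace ℝ (Fin 3)) :
    ∑ j, (Complex.I • EuclideanSpace.complexify ρ) j * ((modeE j : ℤ) : ℂ) = 2 * Complex.I * (ρ 1 : ℂ) := by
  simp [Fin.sum_univ_three, EuclideanSpace.complexify_apply, modeE_apply_zero, modeE_apply_one, modeE_apply_two]
  ring

/-- Scalar of the stretching term at `-e`: `∑ⱼ (i ρ)ⱼ (-e)ⱼ = -2 i ρ₁`. [folklore] -/
theorem sum_I_smul_complexify_mul_neg_modeE (ρ : EuclideanSpace ℝ (Fin 3)) :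
    ∑ j, (Complex.I • EuclideanSpace.complexify ρ) j * (((-modeE) j : ℤ) : ℂ) = -(2 * Complex.I * (ρ 1 : ℂ)) := by
  simp [Fin.sum_univ_three, EuclideanSpace.complexify_apply, modeE_apply_zero, modeE_apply_one, modeE_apply_two]
  ring

/-- Real scalars act through `complexify`: `(r : ℂ) • (i • complexify v) = i • complexify (r • v)`.
[folklore] -/
theorem ofReal_smul_I_smul_complexify (r : ℝ) (v : EuclideanSpace ℝ (Fin 3)) :
    (r : ℂ) • (Complex.I • EuclideanSpace.complexify v) = Complex.I • EuclideanSpace.complexify (r • v) := by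
  rw [LinearIsometry.map_smul, smul_comm, Complex.coe_smul]

/-- **The linearised convection at the laminar shear.** With `h = (Φ y)‾ = i ρ`
(`ρ k' = ∑_q y_q repField q k'`) and `c₀ = û_lam‾`,
`conv(c₀,h)_k + conv(h,c₀)_k = i · πA [ k₀ (ρ(k-e) - ρ(k+e)) + 2 (ρ(k-e)₁ + ρ(k+e)₁) e₀ ]`
(advection by, and stretching of, the shear `A sin(4πx₁)e₀`). [folklore] -/
theorem dconv_laminar {N : ℕ} (hN : 2 ≤ N) (ν F : ℝ) (y : ObliqueIndex N → ℝ) (k : Fin 3 → ℤ) :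
    convectionCoeff (freqBall (d := Fin 3) N) (coeffExt (freqBall (d := Fin 3) N) (obliqueCoeff N (laminarCoord ν F N)))
        (coeffExt (freqBall (d := Fin 3) N) (obliqueCoeff N y)) k +
      convectionCoeff (freqBall (d := Fin 3) N) (coeffExt (freqBall (d := Fin 3) N) (obliqueCoeff N y))
        (coeffExt (freqBall (d := Fin 3) N) (obliqueCoeff N (laminarCoord ν F N))) k =
      Complex.I • EuclideanSpace.complexify
        ((Real.pi * (F / (16 * Real.pi ^ 2 * ν))) •
          (((k 0 : ℤ) : ℝ) • ((∑ q : ObliqueIndex N, y q • repField q (k - modeE)) -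
              (∑ q : ObliqueIndex N, y q • repField q (k + modeE))) +
            (2 * ((∑ q : ObliqueIndex N, y q • repField q (k - modeE)) 1 +
              (∑ q : ObliqueIndex N, y q • repField q (k + modeE)) 1)) •
              EuclideanSpace.single (0 : Fin 3) (1 : ℝ))) := by
  have he := modeE_mem_freqBall hN
  have hne := neg_modeE_mem_freqBall hN
  set A : ℝ := F / (16 * Real.pi ^ 2 * ν) with hA
  set ρm : EuclideanSpace ℝ (Fin 3) := ∑ q : ObliqueIndex N, y q • repField q (k - modeE) with hρm
  set ρp : EuclideanSpace ℝ (Fin 3) := ∑ q : ObliqueIndex N, y q • repField q (k + modeE) with hρp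
  have hsupp := coeffExt_laminar_eq_zero ν F hN
  have hh : ∀ m, m ∉ freqBall (d := Fin 3) N → coeffExt (freqBall (d := Fin 3) N) (obliqueCoeff N y) m = 0 :=
    fun m hm => coeffExt_of_not_mem _ hm
  rw [convectionCoeff_of_support_pair he hne hsupp hh k, convectionCoeff_of_support_pair_right he hne hsupp hh k,
    coeffExt_laminar_modeE ν F hN, coeffExt_laminar_neg_modeE ν F hN,
    coeffExt_obliqueCoeff_eq_repField y (k - modeE), coeffExt_obliqueCoeff_eq_repField y (k + modeE), ← hρm, ← hρp]
  -- the four scalars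
  rw [sum_laminarVec_mul (-(A / 2)) (k - modeE), sum_laminarVec_mul (A / 2) (k + modeE),
    sum_I_smul_complexify_mul_modeE ρm, sum_I_smul_complexify_mul_neg_modeE ρp]
  have hk0 : (k - modeE) 0 = k 0 := by simp [modeE_apply_zero]
  have hk0' : (k + modeE) 0 = k 0 := by simp [modeE_apply_zero]
  rw [hk0, hk0']
  -- rewrite every term as `i • complexify (real vector)`
  have hI : Complex.I * Complex.I = -1 := Complex.I_mul_I
  have t1 : (2 * ↑Real.pi * Complex.I * (((-(A / 2) : ℝ) : ℂ) * Complex.I * ((k 0 : ℤ) : ℂ))) •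
      (Complex.I • EuclideanSpace.complexify ρm) =
      Complex.I • EuclideanSpace.complexify ((Real.pi * A * (k 0 : ℝ)) • ρm) := by
    rw [← ofReal_smul_I_smul_complexify]
    congr 1
    push_cast
    linear_combination (-(↑Real.pi * ↑A * ((k 0 : ℤ) : ℂ))) * hI
  have t2 : (2 * ↑Real.pi * Complex.I * ((((A / 2) : ℝ) : ℂ) * Complex.I * ((k 0 : ℤ) : ℂ))) •
      (Complex.I • EuclideanSpace.complexify ρp) =
      Complex.I • EuclideanSpace.complexify ((-(Real.pi * A * (k 0 : ℝ))) • ρp) := by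
    rw [← ofReal_smul_I_smul_complexify]
    congr 1
    push_cast
    linear_combination (↑Real.pi * ↑A * ((k 0 : ℤ) : ℂ)) * hI
  have t3 : (2 * ↑Real.pi * Complex.I * (2 * Complex.I * ((ρm 1 : ℝ) : ℂ))) •
      ((-(A / 2) : ℝ) • (Complex.I • EuclideanSpace.complexify (EuclideanSpace.single (0 : Fin 3) (1 : ℝ)))) =
      Complex.I • EuclideanSpace.complexify ((2 * Real.pi * A * ρm 1) • EuclideanSpace.single (0 : Fin 3) (1 : ℝ)) := by
    rw [← Complex.coe_smul, smul_smul, ← ofReal_smul_I_smul_complexify]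
    congr 1
    push_cast
    linear_combination (-(2 * ↑Real.pi * ↑A * ((ρm 1 : ℝ) : ℂ))) * hI
  have t4 : (2 * ↑Real.pi * Complex.I * -(2 * Complex.I * ((ρp 1 : ℝ) : ℂ))) •
      (((A / 2) : ℝ) • (Complex.I • EuclideanSpace.complexify (EuclideanSpace.single (0 : Fin 3) (1 : ℝ)))) =
      Complex.I • EuclideanSpace.complexify ((2 * Real.pi * A * ρp 1) • EuclideanSpace.single (0 : Fin 3) (1 : ℝ)) := by
    rw [← Complex.coe_smul, smul_smul, ← ofReal_smul_I_smul_complexify]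
    congr 1
    push_cast
    linear_combination (-(2 * ↑Real.pi * ↑A * ((ρp 1 : ℝ) : ℂ))) * hI
  rw [t1, t2, t3, t4, ← smul_add, ← smul_add, ← smul_add, ← map_add, ← map_add, ← map_add]
  congr 2
  simp only [smul_sub, smul_add, smul_smul, neg_smul]
  module

/-! ### The Leray symbol is invisible in transversal coordinates -/

/-- For a real vector `V` and a real vector `b ⊥ k`: `∑ⱼ bⱼ Im (Π_k (i V))ⱼ = ⟪b, V⟫`
(the Leray correction is along `k`). [folklore] -/
theorem sum_mul_im_leraySym_I_smul (k : Fin 3 → ℤ) (V b : EuclideanSpace ℝ (Fin 3))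
    (hb : ∑ j, (k j : ℝ) * b j = 0) :
    ∑ j, b j * (leraySym k (Complex.I • EuclideanSpace.complexify V) j).im = ∑ j, b j * V j := by
  rw [leraySym_def]
  set c : ℂ := (∑ i, ((k i : ℤ) : ℂ) * (Complex.I • EuclideanSpace.complexify V) i) / (((freqNormSq k : ℝ)) : ℂ)
    with hc
  have hterm : ∀ j, (((Complex.I • EuclideanSpace.complexify V) - c • freqVec k) j).im = V j - c.im * (k j : ℝ) := by
    intro j
    simp [EuclideanSpace.complexify_apply, freqVec_apply, Complex.mul_im]
  simp_rw [hterm, mul_sub, Finset.sum_sub_distrib]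
  have : ∑ j, b j * (c.im * (k j : ℝ)) = c.im * ∑ j, (k j : ℝ) * b j := by
    rw [Finset.mul_sum]; exact Finset.sum_congr rfl fun j _ => by ring
  rw [this, hb, mul_zero, sub_zero]

/-! ### The Galerkin field along an increment -/

/-- **Quadratic expansion of the Galerkin field**: `R(c + h) = R(c) + L_c(h) + Q(h)` with
`L_c(h)_k = -ν4π²|k|² h̄_k - Π_k(conv(c̄,h̄)_k + conv(h̄,c̄)_k)` and `Q(h)_k = -Π_k conv(h̄,h̄)_k`.
[folklore] -/
theorem galerkinRHS_add_apply {N : ℕ} (ν : ℝ) (g c h : ↥(freqBall (d := Fin 3) N) → EuclideanSpace ℂ (Fin 3))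
    (k : ↥(freqBall (d := Fin 3) N)) :
    galerkinRHS (freqBall (d := Fin 3) N) ν g (c + h) k =
      galerkinRHS (freqBall (d := Fin 3) N) ν g c k +
      (-((((ν * (4 * Real.pi ^ 2 * freqNormSq (k : Fin 3 → ℤ))) : ℝ) : ℂ) •
            coeffExt (freqBall (d := Fin 3) N) h k) -
        leraySym (k : Fin 3 → ℤ)
          (convectionCoeff (freqBall (d := Fin 3) N) (coeffExt (freqBall (d := Fin 3) N) c)
              (coeffExt (freqBall (d := Fin 3) N) h) k +
            convectionCoeff (freqBall (d := Fin 3) N) (coeffExt (freqBall (d := Fin 3) N) h)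
              (coeffExt (freqBall (d := Fin 3) N) c) k)) +
      (-leraySym (k : Fin 3 → ℤ)
          (convectionCoeff (freqBall (d := Fin 3) N) (coeffExt (freqBall (d := Fin 3) N) h)
            (coeffExt (freqBall (d := Fin 3) N) h) k)) := by
  simp only [galerkinRHS_apply, galerkinField_def, coeffExt_add, convectionCoeff_add_left, convectionCoeff_add_right,
    Pi.add_apply, smul_add, leraySym_sub, leraySym_add]
  abel

/-- `Φ` of the laminar point plus an increment. [folklore] -/
theorem obliqueField_add {N : ℕ} (ν F : ℝ) (x y : ObliqueIndex N → ℝ) :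
    obliqueField ν F N (x + y) =
      obliqueField ν F N x +
      (-obliqueCoord N (fun k =>
        (-((((ν * (4 * Real.pi ^ 2 * freqNormSq (k : Fin 3 → ℤ))) : ℝ) : ℂ) •
              coeffExt (freqBall (d := Fin 3) N) (obliqueCoeff N y) k) -
          leraySym (k : Fin 3 → ℤ)
            (convectionCoeff (freqBall (d := Fin 3) N) (coeffExt (freqBall (d := Fin 3) N) (obliqueCoeff N x))
                (coeffExt (freqBall (d := Fin 3) N) (obliqueCoeff N y)) k +
              convectionCoeff (freqBall (d := Fin 3) N) (coeffExt (freqBall (d := Fin 3) N) (obliqueCoeff N y))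
                (coeffExt (freqBall (d := Fin 3) N) (obliqueCoeff N x)) k)))) +
      obliqueCoord N (fun k => leraySym (k : Fin 3 → ℤ)
          (convectionCoeff (freqBall (d := Fin 3) N) (coeffExt (freqBall (d := Fin 3) N) (obliqueCoeff N y))
            (coeffExt (freqBall (d := Fin 3) N) (obliqueCoeff N y)) k)) := by
  rw [obliqueField_apply, obliqueField_apply, obliqueCoeff_add]
  have hfun : galerkinRHS (freqBall (d := Fin 3) N) ν (kolmogorovCoeff F N) (obliqueCoeff N x + obliqueCoeff N y) =
      galerkinRHS (freqBall (d := Fin 3) N) ν (kolmogorovCoeff F N) (obliqueCoeff N x) +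
      (fun k : ↥(freqBall (d := Fin 3) N) => (-((((ν * (4 * Real.pi ^ 2 * freqNormSq (k : Fin 3 → ℤ))) : ℝ) : ℂ) •
              coeffExt (freqBall (d := Fin 3) N) (obliqueCoeff N y) k) -
          leraySym (k : Fin 3 → ℤ)
            (convectionCoeff (freqBall (d := Fin 3) N) (coeffExt (freqBall (d := Fin 3) N) (obliqueCoeff N x))
                (coeffExt (freqBall (d := Fin 3) N) (obliqueCoeff N y)) k +
              convectionCoeff (freqBall (d := Fin 3) N) (coeffExt (freqBall (d := Fin 3) N) (obliqueCoeff N y))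
                (coeffExt (freqBall (d := Fin 3) N) (obliqueCoeff N x)) k))) +
      (-(fun k : ↥(freqBall (d := Fin 3) N) => leraySym (k : Fin 3 → ℤ)
          (convectionCoeff (freqBall (d := Fin 3) N) (coeffExt (freqBall (d := Fin 3) N) (obliqueCoeff N y))
            (coeffExt (freqBall (d := Fin 3) N) (obliqueCoeff N y)) k))) := by
    funext k
    rw [Pi.add_apply, Pi.add_apply, Pi.neg_apply, galerkinRHS_add_apply]
  rw [hfun, obliqueCoord_add, obliqueCoord_add, obliqueCoord_neg]
  abel

end Summit.AnomalousDissipation.AnomalousDissipation.Theorems.Oblique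

end
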